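import Summits.QuantumFields.YangMills.Theorems.FemtoCurvatureSkewness.Negative.ZeroCoupling

/-!
# Route `LangevinControlUV`: the typed `∀ a` item `FemtoCurvatureSkewness` (stmt-QuantumFields-9365) versus its C′ repair

Item-scoped prover seat `prover-pitem-stmt-QuantumFields-9365-0` (2026-08-16), `--supports stmt-QuantumFields-9365`.

Since route revision 15/16 (repair C′) the deciding theorem `closes` of `Theses/LangevinControlUV.lean` consumes the
∃-bundled, continuity-pinned crux `FemtoCurvatureSkewnessC` (stmt-QuantumFields-16205) and no longer the typed `∀ a` item
`FemtoCurvatureSkewness` (stmt-QuantumFields-9365), which stays in the route file as a SUPPORT edge because landed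
`Theorems` elaborate against its body.  This file records, kernel-checked and with nothing asserted:

* `femtoCurvatureSkewnessC_iff` — the served crux unbundled into the tree vocabulary of
  `Theorems/FemtoCurvatureSkewness/Negative/ZeroCoupling.lean` (`TwoPointPackage`, `SkewnessPackage`; definitional, `Iff.rfl`):
  `∀ G simple, ∀ r, (∃ a, Continuous a ∧ TwoPointPackage r a) → ∃ a, Continuous a ∧ TwoPointPackage r a ∧ SkewnessPackage r a`;
* `femtoCurvatureSkewnessC_of_femtoCurvatureSkewness` — the support edge itself: the typed `∀ a` item IMPLIES the served
  crux (evaluate the `∀ a` statement at the given continuous package map), so 9365 is a strengthening of what the route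
  needs, never an extra obligation;
* `femtoCurvatureSkewnessC_of_forall_continuous` — already the intermediate "honest `∀ a`" form (the typed item restricted
  to CONTINUOUS unit maps, which the wild-map collapse `twoPointPackage_wild` / `packagePinsScale_iff_package_unsatisfiable`
  does not reach) implies the served crux.

What is deliberately NOT here: any claim about the truth of either item.  The typed item is, modulo standard covariance
uniformities, R1 + global eventual non-vanishing of `κ₃` in all volumes (`kappa3_ne_zero_of_femtoCurvatureSkewness`,
`Negative/GlobalNonvanishingOfCrux.lean`), and its conditional refutation is `FemtoCurvatureSkewness_false_of_UniformZeros`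
(`Negative/FalseOfUniformZeros.lean`).
-/

set_option autoImplicit false

noncomputable section

namespace Summit.QuantumFields.YangMills.Theorems.FemtoCurvatureSkewness

open MeasureTheory Filter Topology
open Literature.MathematicalPhysics.QuantumFieldTheory
open Summit.QuantumFields.YangMills.Theses.LangevinControlUV (FemtoCurvatureSkewness FemtoCurvatureSkewnessC)
open Summit.QuantumFields.YangMills.Theorems.FemtoCurvatureSkewness.Negative (TwoPointPackage SkewnessPackage)

/-- **The served crux `FemtoCurvatureSkewnessC` (stmt-QuantumFields-16205), unbundled** into the vocabulary
`TwoPointPackage` / `SkewnessPackage` of `Negative/ZeroCoupling.lean`: for every compact simple `G` and every lattice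
representation `r`, if SOME continuous unit map carries the femto two-point package then SOME continuous unit map carries the
package together with the skewness package.  Definitional (`Iff.rfl`). -/
theorem femtoCurvatureSkewnessC_iff : FemtoCurvatureSkewnessC ↔
    ∀ (G : Type) [Group G] [TopologicalSpace G] [IsTopologicalGroup G] [CompactSpace G],
      IsCompactSimpleLieGroup G →
        letI : MeasurableSpace G := borel G
        haveI : BorelSpace G := ⟨rfl⟩
        ∀ (r : LatticeRep G), (∃ a : ℝ → ℝ, Continuous a ∧ TwoPointPackage r a) →
          ∃ a : ℝ → ℝ, Continuous a ∧ TwoPointPackage r a ∧ SkewnessPackage r a :=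
  Iff.rfl

/-- **Support edge 9365 ⟹ 16205**: the typed `∀ a` item `FemtoCurvatureSkewness` implies the served C′ crux
`FemtoCurvatureSkewnessC` — given a continuous unit map `a` carrying the two-point package, the `∀ a` statement evaluated at
that very `a` supplies its skewness package. -/
theorem femtoCurvatureSkewnessC_of_femtoCurvatureSkewness : FemtoCurvatureSkewness → FemtoCurvatureSkewnessC := by
  intro h G _ _ _ _ hG
  letI : MeasurableSpace G := borel G
  haveI : BorelSpace G := ⟨rfl⟩
  intro r hex
  obtain ⟨a, ha, hP⟩ := hex
  exact ⟨a, ha, hP, h G hG r a hP⟩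

/-- **The honest-`∀ a` intermediate already suffices**: if for every compact simple `G`, every `r` and every CONTINUOUS
unit map `a` the two-point package implies the skewness package, then `FemtoCurvatureSkewnessC` holds.  (This intermediate
is strictly between the typed item and the served crux in logical strength: it drops exactly the wild / generic-step unit
maps on which the typed `∀ a` shell over-reaches.) -/
theorem femtoCurvatureSkewnessC_of_forall_continuous
    (h : ∀ (G : Type) [Group G] [TopologicalSpace G] [IsTopologicalGroup G] [CompactSpace G],
      IsCompactSimpleLieGroup G →
        letI : MeasurableSpace G := borel G
        haveI : BorelSpace G := ⟨rfl⟩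
        ∀ (r : LatticeRep G) (a : ℝ → ℝ), Continuous a → TwoPointPackage r a → SkewnessPackage r a) :
    FemtoCurvatureSkewnessC := by
  intro G _ _ _ _ hG
  letI : MeasurableSpace G := borel G
  haveI : BorelSpace G := ⟨rfl⟩
  intro r hex
  obtain ⟨a, ha, hP⟩ := hex
  exact ⟨a, ha, hP, h G hG r a ha hP⟩

/-- The typed `∀ a` item trivially yields the honest-`∀ a` intermediate (restriction to continuous unit maps). -/
theorem forall_continuous_of_femtoCurvatureSkewness (h : FemtoCurvatureSkewness) :
    ∀ (G : Type) [Group G] [TopologicalSpace G] [IsTopologicalGroup G] [CompactSpace G],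
      IsCompactSimpleLieGroup G →
        letI : MeasurableSpace G := borel G
        haveI : BorelSpace G := ⟨rfl⟩
        ∀ (r : LatticeRep G) (a : ℝ → ℝ), Continuous a → TwoPointPackage r a → SkewnessPackage r a := by
  intro G _ _ _ _ hG
  letI : MeasurableSpace G := borel G
  haveI : BorelSpace G := ⟨rfl⟩
  intro r a _ hP
  exact h G hG r a hP

end Summit.QuantumFields.YangMills.Theorems.FemtoCurvatureSkewness

end
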